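import Mathlib.Geometry.Manifold.PartitionOfUnity
import Literature.Geometry.Kaehler.LocalForms
import HarnessLib

/-!
# Gluing local forms, smooth cut-offs, and bump pairs for a two-set open cover

Support for the finite-dimensionality of de Rham cohomology
(`Literature.AlgebraicGeometry.Motives.finite_deRhamCohomology`; Mayer–Vietoris route), on top
of `Literature.Geometry.Kaehler.LocalForms` (forms on open subsets of a manifold, realised inside
`MForm I M F k` by extension by zero).

* `MForm.SmoothAt.fun_smul`: a smooth function times a form smooth at `x` is smooth at `x`;
* `MForm.glue P Q u v`: the form equal to `u` on `P`, to `v` on `Q ∖ P`, and `0` elsewhere; when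
  `u`, `v` are forms on the open sets `P`, `Q` agreeing on `P ∩ Q` it is a form on `P ∪ Q`
  (`glue_mem_smoothFormsOn`) restricting to `u` and `v` (exactness of the Mayer–Vietoris
  sequence of forms in the middle, Bott–Tu (1982), Prop. 2.3);
* `BumpPair I P Q`: a pair of functions `ρ_P, ρ_Q`, smooth at the points of `P ∪ Q`, with
  `ρ_P + ρ_Q = 1` on `P ∪ Q`, `ρ_Q ≡ 0` near `P ∖ Q` and `ρ_P ≡ 0` near `Q ∖ P` — exactly what
  the connecting homomorphism needs; `exists_bumpPair`: existence for open `P`, `Q` in a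
  Hausdorff second-countable manifold on a finite-dimensional model, from Mathlib's smooth
  partitions of unity on the open submanifold `↥(P ∪ Q)` (`SmoothPartitionOfUnity.exists_isSubordinate`,
  transferred with `contMDiffAt_subtype_iff`).

## References

* R. Bott, L. W. Tu, *Differential Forms in Algebraic Topology* (1982), §I.2, Prop. 2.3.
* J. M. Lee, *Introduction to Smooth Manifolds*, 2nd ed. (2013), Thm. 17.20 and pp. 449–450
  (proof of the Mayer–Vietoris theorem), Thm. 2.23 (partitions of unity).
-/

noncomputable section

open scoped Manifold ContDiff Topology
open Bundle Set Filter

namespace Literature.Geometry.Kaehler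

variable {E : Type*} [NormedAddCommGroup E] [NormedSpace ℝ E]
  {H : Type*} [TopologicalSpace H] {I : ModelWithCorners ℝ E H}
  {M : Type*} [TopologicalSpace M] [ChartedSpace H M]
  {F : Type*} [NormedAddCommGroup F] [NormedSpace ℝ F] {k : ℕ}

/-! ### Smooth functions times forms -/

/-- The chart representative of `ρ • α` is `(ρ ∘ e.symm) • (α.inChart x₀)`. [folklore] -/
theorem MForm.inChart_fun_smul (ρ : M → ℝ) (α : MForm I M F k) (x₀ : M) :
    (ρ • α).inChart x₀ = fun y ↦ ρ ((extChartAt I x₀).symm y) • α.inChart x₀ y := by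
  funext y
  ext v
  simp only [MForm.inChart_apply, Pi.smul_apply']
  rfl

/-- **A smooth function times a form smooth at `x` is smooth at `x`.** [folklore] -/
theorem MForm.SmoothAt.fun_smul {ρ : M → ℝ} {α : MForm I M F k} {x : M}
    (hρ : ContMDiffAt I 𝓘(ℝ) ∞ ρ x) (hα : α.SmoothAt x) : (ρ • α).SmoothAt x := by
  have h1 : ContDiffWithinAt ℝ ∞ (ρ ∘ (extChartAt I x).symm) (range I) (extChartAt I x x) := by
    simpa using (contMDiffAt_iff.1 hρ).2
  rw [MForm.SmoothAt, MForm.inChart_fun_smul]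
  exact h1.smul hα

/-- A form vanishing near `x` is smooth at `x`. [folklore] -/
theorem MForm.smoothAt_of_eventuallyEq_zero {α : MForm I M F k} {x : M} (h : ∀ᶠ y in 𝓝 x, α y = 0) :
    α.SmoothAt x :=
  (MForm.smoothAt_zero x).congr_of_eventuallyEq (h.mono fun _ hy ↦ hy.symm)

/-- A smooth function (at the points of `U`) times a form on `U` is a form on `U`. [folklore] -/
theorem fun_smul_mem_smoothFormsOn {U : Set M} {ρ : M → ℝ} (hρ : ∀ x ∈ U, ContMDiffAt I 𝓘(ℝ) ∞ ρ x)
    {α : MForm I M F k} (hα : α ∈ smoothFormsOn I F U k) : ρ • α ∈ smoothFormsOn I F U k :=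
  ⟨fun x hx ↦ (hα.1 x hx).fun_smul (hρ x hx),
    fun x hx ↦ by rw [Pi.smul_apply', hα.2 x hx, smul_zero]⟩

/-! ### Gluing forms along a two-set cover -/

namespace MForm

/-- **Gluing**: the form equal to `u` on `P`, to `v` on `Q ∖ P`, and to `0` off `P ∪ Q`.
[folklore] -/
def glue (P Q : Set M) (u v : MForm I M F k) : MForm I M F k := u.restr P + v.restr (Q \ P)

/-- On `P` the glued form is `u`. [folklore] -/
theorem glue_apply_of_mem_left {P Q : Set M} (u v : MForm I M F k) {x : M} (hx : x ∈ P) :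
    glue P Q u v x = u x := by
  simp [glue, hx]

/-- On `Q ∖ P` the glued form is `v`. [folklore] -/
theorem glue_apply_of_mem_right_of_notMem {P Q : Set M} (u v : MForm I M F k) {x : M} (hxQ : x ∈ Q)
    (hxP : x ∉ P) : glue P Q u v x = v x := by
  simp [glue, hxQ, hxP]

/-- On `Q` the glued form is `v`, provided `u` and `v` agree on `P ∩ Q`. [folklore] -/
theorem glue_apply_of_mem_right {P Q : Set M} {u v : MForm I M F k} (huv : ∀ y ∈ P ∩ Q, u y = v y)
    {x : M} (hxQ : x ∈ Q) : glue P Q u v x = v x := by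
  by_cases hxP : x ∈ P
  · rw [glue_apply_of_mem_left u v hxP, huv x ⟨hxP, hxQ⟩]
  · exact glue_apply_of_mem_right_of_notMem u v hxQ hxP

/-- Off `P ∪ Q` the glued form vanishes. [folklore] -/
theorem glue_apply_of_notMem {P Q : Set M} (u v : MForm I M F k) {x : M} (hxP : x ∉ P) (hxQ : x ∉ Q) :
    glue P Q u v x = 0 := by
  simp [glue, hxP, hxQ]

/-- Near a point of the open set `P` the glued form is `u`. [folklore] -/
theorem glue_eventuallyEq_left {P Q : Set M} (hP : IsOpen P) (u v : MForm I M F k) {x : M} (hx : x ∈ P) :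
    ∀ᶠ y in 𝓝 x, glue P Q u v y = u y := by
  filter_upwards [hP.mem_nhds hx] with y hy
  exact glue_apply_of_mem_left u v hy

/-- Near a point of the open set `Q` the glued form is `v`, provided `u` and `v` agree on
`P ∩ Q`. [folklore] -/
theorem glue_eventuallyEq_right {P Q : Set M} (hQ : IsOpen Q) {u v : MForm I M F k}
    (huv : ∀ y ∈ P ∩ Q, u y = v y) {x : M} (hx : x ∈ Q) : ∀ᶠ y in 𝓝 x, glue P Q u v y = v y := by
  filter_upwards [hQ.mem_nhds hx] with y hy
  exact glue_apply_of_mem_right huv hy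

/-- The glued form restricts to `u` on `P` if `u` vanishes off `P`. [folklore] -/
theorem restr_glue_left {P Q : Set M} {u : MForm I M F k} (hu : ∀ x ∉ P, u x = 0) (v : MForm I M F k) :
    (glue P Q u v).restr P = u := by
  funext x
  by_cases hx : x ∈ P
  · rw [restr_apply_of_mem _ hx, glue_apply_of_mem_left u v hx]
  · rw [restr_apply_of_notMem _ hx, hu x hx]

/-- The glued form restricts to `v` on `Q` if `v` vanishes off `Q` and agrees with `u` on
`P ∩ Q`. [folklore] -/
theorem restr_glue_right {P Q : Set M} {u v : MForm I M F k} (huv : ∀ y ∈ P ∩ Q, u y = v y)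
    (hv : ∀ x ∉ Q, v x = 0) : (glue P Q u v).restr Q = v := by
  funext x
  by_cases hx : x ∈ Q
  · rw [restr_apply_of_mem _ hx, glue_apply_of_mem_right huv hx]
  · rw [restr_apply_of_notMem _ hx, hv x hx]

end MForm

/-- **Exactness of the Mayer–Vietoris sequence of forms in the middle**: forms on the open sets
`P` and `Q` that agree on `P ∩ Q` glue to a form on `P ∪ Q` (Bott–Tu (1982), Prop. 2.3).
[cite: BottTu1982Forms, Prop. 2.3] -/
theorem glue_mem_smoothFormsOn {P Q : Set M} (hP : IsOpen P) (hQ : IsOpen Q) {u v : MForm I M F k}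
    (hu : u ∈ smoothFormsOn I F P k) (hv : v ∈ smoothFormsOn I F Q k)
    (huv : ∀ y ∈ P ∩ Q, u y = v y) : MForm.glue P Q u v ∈ smoothFormsOn I F (P ∪ Q) k := by
  refine ⟨fun x hx ↦ ?_, fun x hx ↦ ?_⟩
  · rcases hx with hx | hx
    · exact (hu.1 x hx).congr_of_eventuallyEq
        ((MForm.glue_eventuallyEq_left hP u v hx).mono fun _ h ↦ h.symm)
    · exact (hv.1 x hx).congr_of_eventuallyEq
        ((MForm.glue_eventuallyEq_right hQ huv hx).mono fun _ h ↦ h.symm)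
  · rw [mem_union, not_or] at hx
    exact MForm.glue_apply_of_notMem u v hx.1 hx.2

/-- `d` of a glued form at a point of `P` is `d u`. [folklore] -/
theorem mextDeriv_glue_of_mem_left {P Q : Set M} (hP : IsOpen P) (u v : MForm I M F k) {x : M}
    (hx : x ∈ P) : mextDeriv (MForm.glue P Q u v) x = mextDeriv u x :=
  mextDeriv_congr_of_eventuallyEq (MForm.glue_eventuallyEq_left hP u v hx)

/-- `d` of a glued form at a point of `Q` is `d v` (if `u`, `v` agree on `P ∩ Q`). [folklore] -/
theorem mextDeriv_glue_of_mem_right {P Q : Set M} (hQ : IsOpen Q) {u v : MForm I M F k}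
    (huv : ∀ y ∈ P ∩ Q, u y = v y) {x : M} (hx : x ∈ Q) :
    mextDeriv (MForm.glue P Q u v) x = mextDeriv v x :=
  mextDeriv_congr_of_eventuallyEq (MForm.glue_eventuallyEq_right hQ huv hx)

/-! ### Bump pairs -/

variable (I) in
/-- **Bump pair** for the two sets `P`, `Q`: functions `ρ_P, ρ_Q : M → ℝ`, `C^∞` at the points
of `P ∪ Q`, with `ρ_P + ρ_Q = 1` on `P ∪ Q`, `ρ_Q` vanishing near every point of `P ∖ Q` and
`ρ_P` vanishing near every point of `Q ∖ P` (a smooth partition of unity on `P ∪ Q` subordinate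
to `{P, Q}`, with exactly the properties used by the Mayer–Vietoris connecting homomorphism;
Lee (2013), p. 449). [cite: LeeSmoothManifolds2013, Thm. 17.20] -/
structure BumpPair (P Q : Set M) where
  /-- the function attached to `P` -/
  ρP : M → ℝ
  /-- the function attached to `Q` -/
  ρQ : M → ℝ
  /-- `ρ_P` is smooth at the points of `P ∪ Q` -/
  contMDiffAt_ρP : ∀ x ∈ P ∪ Q, ContMDiffAt I 𝓘(ℝ) ∞ ρP x
  /-- `ρ_Q` is smooth at the points of `P ∪ Q` -/
  contMDiffAt_ρQ : ∀ x ∈ P ∪ Q, ContMDiffAt I 𝓘(ℝ) ∞ ρQ x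
  /-- `ρ_P + ρ_Q = 1` on `P ∪ Q` -/
  add_eq_one : ∀ x ∈ P ∪ Q, ρP x + ρQ x = 1
  /-- `ρ_Q ≡ 0` near `P ∖ Q` -/
  ρQ_eventuallyEq_zero : ∀ x ∈ P \ Q, ∀ᶠ y in 𝓝 x, ρQ y = 0
  /-- `ρ_P ≡ 0` near `Q ∖ P` -/
  ρP_eventuallyEq_zero : ∀ x ∈ Q \ P, ∀ᶠ y in 𝓝 x, ρP y = 0

namespace BumpPair

variable {P Q : Set M} (b : BumpPair I P Q)

/-- The two functions of a bump pair may be swapped. [folklore] -/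
def symm : BumpPair I Q P where
  ρP := b.ρQ
  ρQ := b.ρP
  contMDiffAt_ρP x hx := b.contMDiffAt_ρQ x (by rwa [union_comm])
  contMDiffAt_ρQ x hx := b.contMDiffAt_ρP x (by rwa [union_comm])
  add_eq_one x hx := by rw [add_comm]; exact b.add_eq_one x (by rwa [union_comm])
  ρQ_eventuallyEq_zero := b.ρP_eventuallyEq_zero
  ρP_eventuallyEq_zero := b.ρQ_eventuallyEq_zero

/-- **`ρ_Q • γ`, for a form `γ` on `P ∩ Q`, is a form on `P`** (smooth on `P ∩ Q` as a product,
and `≡ 0` near `P ∖ Q`). This is the extension by zero used to define the connecting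
homomorphism (Lee (2013), p. 450). [cite: LeeSmoothManifolds2013, Thm. 17.20] -/
theorem smul_restr_mem_left (hP : IsOpen P) {γ : MForm I M F k} (hγ : γ ∈ smoothFormsOn I F (P ∩ Q) k) :
    (b.ρQ • γ).restr P ∈ smoothFormsOn I F P k := by
  refine ⟨fun x hx ↦ (MForm.smoothAt_restr_iff hP _ hx).2 ?_, fun x hx ↦ MForm.restr_apply_of_notMem _ hx⟩
  by_cases hxQ : x ∈ Q
  · exact (hγ.1 x ⟨hx, hxQ⟩).fun_smul (b.contMDiffAt_ρQ x (Or.inl hx))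
  · refine MForm.smoothAt_of_eventuallyEq_zero ?_
    filter_upwards [b.ρQ_eventuallyEq_zero x ⟨hx, hxQ⟩] with y hy
    rw [Pi.smul_apply', hy, zero_smul]

/-- `ρ_P • γ`, for a form `γ` on `P ∩ Q`, is a form on `Q`. [cite: LeeSmoothManifolds2013, Thm. 17.20] -/
theorem smul_restr_mem_right (hQ : IsOpen Q) {γ : MForm I M F k} (hγ : γ ∈ smoothFormsOn I F (P ∩ Q) k) :
    (b.ρP • γ).restr Q ∈ smoothFormsOn I F Q k :=
  b.symm.smul_restr_mem_left hQ (by rwa [inter_comm])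

/-- On `P ∩ Q`, `ρ_Q • γ + ρ_P • γ = γ`. [folklore] -/
theorem smul_add_smul_apply {γ : MForm I M F k} {x : M} (hx : x ∈ P ∪ Q) :
    (b.ρQ • γ) x + (b.ρP • γ) x = γ x := by
  rw [Pi.smul_apply', Pi.smul_apply', ← add_smul, add_comm, b.add_eq_one x hx, one_smul]

end BumpPair

/-- **Existence of bump pairs.** For open sets `P`, `Q` of a Hausdorff, second-countable `C^∞`
manifold on a finite-dimensional model there is a bump pair: take a smooth partition of unity on
the open submanifold `↥(P ∪ Q)` subordinate to `{P, Q}` (Mathlib's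
`SmoothPartitionOfUnity.exists_isSubordinate`; `↥(P ∪ Q)` is σ-compact as a second-countable
locally compact space) and extend its two functions by `0`; smoothness at the points of `P ∪ Q`
transfers by `contMDiffAt_subtype_iff`. Lee (2013), Thm. 2.23. [cite: LeeSmoothManifolds2013, Thm. 2.23] -/
theorem exists_bumpPair [FiniteDimensional ℝ E] [IsManifold I ∞ M] [T2Space M]
    [SecondCountableTopology M] {P Q : Set M} (hP : IsOpen P) (hQ : IsOpen Q) :
    Nonempty (BumpPair I P Q) := by
  classical
  set Ω : TopologicalSpace.Opens M := ⟨P ∪ Q, hP.union hQ⟩ with hΩ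
  have hΩo : IsOpen (P ∪ Q) := hP.union hQ
  haveI : LocallyCompactSpace M := Manifold.locallyCompact_of_finiteDimensional I
  haveI : LocallyCompactSpace Ω := hΩo.locallyCompactSpace
  -- a smooth partition of unity on `Ω` subordinate to `{P, Q}`
  set W : Bool → Set Ω := fun c ↦ if c then Subtype.val ⁻¹' P else Subtype.val ⁻¹' Q with hW
  have hWo : ∀ c, IsOpen (W c) := fun c ↦ by
    cases c
    · exact hQ.preimage continuous_subtype_val
    · exact hP.preimage continuous_subtype_val
  have hcov : (univ : Set Ω) ⊆ ⋃ c, W c := by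
    rintro ⟨x, hx⟩ -
    rcases hx with hx | hx
    · exact mem_iUnion.2 ⟨true, hx⟩
    · exact mem_iUnion.2 ⟨false, hx⟩
  obtain ⟨f, hf⟩ := SmoothPartitionOfUnity.exists_isSubordinate I isClosed_univ W hWo hcov
  -- extension by zero of the two functions
  set ρ : Bool → M → ℝ := fun c x ↦ if hx : x ∈ P ∪ Q then f c ⟨x, hx⟩ else 0 with hρ
  have hρΩ : ∀ c (y : Ω), ρ c y = f c y := fun c y ↦ by
    show (if hx : (y : M) ∈ P ∪ Q then f c ⟨y, hx⟩ else 0) = f c y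
    rw [dif_pos (show (y : M) ∈ P ∪ Q from y.2)]
  have hsmooth : ∀ c, ∀ x ∈ P ∪ Q, ContMDiffAt I 𝓘(ℝ) ∞ (ρ c) x := by
    intro c x hx
    have h := (contMDiffAt_subtype_iff (I := I) (I' := 𝓘(ℝ, ℝ)) (n := ∞) (U := Ω) (f := ρ c)
      (x := ⟨x, hx⟩)).1
    refine h ?_
    have : (fun y : Ω ↦ ρ c y) = f c := funext (hρΩ c)
    rw [this]
    exact (f c).contMDiff.contMDiffAt
  have hsum : ∀ x ∈ P ∪ Q, ρ true x + ρ false x = 1 := by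
    intro x hx
    have h := f.sum_eq_one (mem_univ (⟨x, hx⟩ : Ω))
    rw [finsum_eq_sum_of_fintype, Fintype.sum_bool] at h
    rw [show ρ true x = f true ⟨x, hx⟩ from hρΩ true ⟨x, hx⟩,
      show ρ false x = f false ⟨x, hx⟩ from hρΩ false ⟨x, hx⟩]
    exact h
  -- vanishing near the complementary pieces
  have hzero : ∀ c, ∀ x (hx : x ∈ P ∪ Q), (⟨x, hx⟩ : Ω) ∉ W c → ∀ᶠ y in 𝓝 x, ρ c y = 0 := by
    intro c x hx hxW
    have h1 : (⟨x, hx⟩ : Ω) ∉ tsupport (f c) := fun h ↦ hxW (hf c h)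
    have h2 : ∀ᶠ y in 𝓝 (⟨x, hx⟩ : Ω), f c y = 0 := notMem_tsupport_iff_eventuallyEq.1 h1
    have h3 : ∀ᶠ y : Ω in 𝓝 (⟨x, hx⟩ : Ω), ρ c (y : M) = 0 :=
      h2.mono fun y hy ↦ by rw [hρΩ c y, hy]
    rw [← map_nhds_subtype_coe_eq_nhds hx (hΩo.mem_nhds hx), eventually_map]
    exact h3
  refine ⟨{ ρP := ρ true
            ρQ := ρ false
            contMDiffAt_ρP := hsmooth true
            contMDiffAt_ρQ := hsmooth false
            add_eq_one := hsum
            ρQ_eventuallyEq_zero := fun x hx ↦ hzero false x (Or.inl hx.1) hx.2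
            ρP_eventuallyEq_zero := fun x hx ↦ hzero true x (Or.inr hx.1) hx.2 }⟩

end Literature.Geometry.Kaehler
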